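import Literature.Probability.RandomPlanarGeometry.SAWBridgeSpanGF
import Literature.Probability.RandomPlanarGeometry.SAWReflect
import Literature.Probability.RandomPlanarGeometry.SAWPolygonsFromBridges
import Literature.Probability.RandomPlanarGeometry.SAWMassNormProofs
import Mathlib.Algebra.Order.Chebyshev
import HarnessLib

/-!
# The reflection bound for bridges by span: `b_{N,L}² ≤ (2N+1)^{d-1} · c_{2N+1}(0 → (2L+1)e₁)`

Topic `Literature/Probability/RandomPlanarGeometry` (continues `SAWBridgeSpanGF.lean`: bridges by span `Zd.brSpan`;
`SAWReflect.lean`: the reflection `Zd.reflAt`; `SAWCount.lean`: `Zd.countAt`, `Zd.sawFun`).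

Source / method: N. Madras, G. Slade, *The Self-Avoiding Walk* (1993), §3.1 (bridges, unfolding and reflection arguments,
Hammersley–Welsh) and §1.2 (concatenation): a bridge `ω` of span `L` followed by one step `+e₁` and then by the REFLECTION (in the
hyperplane `x₁ = L + ½`) of a second bridge `ω'` of span `L` traversed backwards is a self-avoiding walk of `2N+1` steps (the
head lives in `0 ≤ x₁ ≤ L`, the tail in `L+1 ≤ x₁ ≤ 2L+1`); when `ω(N) = ω'(N)` it ends at `(2L+1)e₁`, and the pair is recovered
from the walk.  Summing over the common endpoint and applying Cauchy–Schwarz over the at most `(2N+1)^{d-1}` transverse endpoint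
values gives the bound.  STATUS OF THE STATEMENT: the METHOD (reflection of a tail in a hyperplane, unfolding of bridges,
concatenation) is Madras–Slade §3.1 / §1.2 as cited; the INEQUALITY itself is NOT LOCATED IN PRINT — elementary; it is the lane's
lemma R29.2 (venture «pcv-sawmu», a-idea-1 ROUTES-G7 §R29: input to an explicit modulus for the two-point mass at `z_c`).

## Contents (namespace `Literature.Probability.RandomPlanarGeometry.SAW.Zd`, dimension written `d + 1`; 0 sorries)

* `reflJoin` — the `(2N+1)`-step walk built from a pair of `N`-step bridges of span `L`;
* `reflJoin_mem_sawFun` — it is self-avoiding from `0` to `(2L+1)e₁` when the two bridges share their endpoint;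
* `card_endpoint_pairs_le_countAt` — `Σ_y b_{N,L,y}² ≤ c_{2N+1}(0 → (2L+1)e₁)`;
* **`card_brSpan_sq_le`** — `b_{N,L}² ≤ (2N+1)^d · c_{2N+1}(0 → (2L+1)e₁)` on `ℤ^{d+1}`.
-/

noncomputable section

open Finset Literature.Probability.LatticeModels
open scoped BigOperators

namespace Literature.Probability.RandomPlanarGeometry.SAW.Zd

variable {d : ℕ}

/-- The reflected join of two `N`-step walks: `ω` up to time `N`, then the mirror image (in `x₁ = L + ½`) of `ω'` run
backwards, reaching the mirror image of the origin, `(2L+1)e₁`, at time `2N+1`.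
[cite: MadrasSlade1993, §3.1 (reflection of the tail of a walk in a hyperplane)] -/
def reflJoin (N : ℕ) (L : ℤ) (ω ω' : ℕ → Site (d + 1)) (i : ℕ) : Site (d + 1) :=
  if i ≤ N then ω i else reflAt 0 (2 * L + 1) (ω' (2 * N + 1 - i))

/-- (unfolding) [folklore] -/
private theorem reflJoin_of_le {N : ℕ} {L : ℤ} {ω ω' : ℕ → Site (d + 1)} {i : ℕ} (h : i ≤ N) :
    reflJoin N L ω ω' i = ω i := by simp [reflJoin, h]

/-- (unfolding) [folklore] -/
private theorem reflJoin_of_gt {N : ℕ} {L : ℤ} {ω ω' : ℕ → Site (d + 1)} {i : ℕ} (h : N < i) :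
    reflJoin N L ω ω' i = reflAt 0 (2 * L + 1) (ω' (2 * N + 1 - i)) := by simp [reflJoin, not_le.2 h]

/-- First coordinates along a bridge of span `L` lie in `[0, L]`. [cite: MadrasSlade1993, Definition 1.2.4] -/
theorem apply_zero_mem_of_mem_brSpan {N : ℕ} {L : ℤ} {ω : ℕ → Site (d + 1)} (hω : ω ∈ brSpan (d + 1) N L)
    (i : ℕ) : 0 ≤ ω i 0 ∧ ω i 0 ≤ L := by
  obtain ⟨hb, hL⟩ := mem_brSpan.1 hω
  obtain ⟨hs, hbr⟩ := mem_bridges.1 hb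
  obtain ⟨h0, hend, -, -⟩ := mem_saws.1 hs
  have h00 : ω 0 0 = 0 := by rw [h0]; rfl
  by_cases hi : i = 0
  · subst hi
    rw [h00]
    refine ⟨le_rfl, ?_⟩
    rcases Nat.eq_zero_or_pos N with rfl | hN
    · rw [← hL, h00]
    · have := (hbr N hN le_rfl).1
      rw [h00] at this; rw [← hL]; exact this.le
  · rcases le_or_gt i N with hiN | hiN
    · have := hbr i (by omega) hiN
      rw [h00] at this; rw [← hL]; exact ⟨this.1.le, this.2⟩
    · rw [hend i hiN.le, hL]
      refine ⟨?_, le_rfl⟩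
      rcases Nat.eq_zero_or_pos N with rfl | hN
      · rw [← hL, h00]
      · have := (hbr N hN le_rfl).1; rw [h00, hL] at this; exact this.le

/-- **The reflected join of two bridges of span `L` with a common endpoint is a `(2N+1)`-step self-avoiding walk from `0`
to `(2L+1)e₁`.** [cite: MadrasSlade1993, §3.1 (reflection in a hyperplane keeps self-avoidance when the two pieces are separated)] -/
theorem reflJoin_mem_sawFun {N : ℕ} {L : ℤ} {ω ω' : ℕ → Site (d + 1)} (hω : ω ∈ brSpan (d + 1) N L)
    (hω' : ω' ∈ brSpan (d + 1) N L) (hend : ω N = ω' N) :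
    reflJoin N L ω ω' ∈ sawFun (d + 1) (2 * N + 1) (Pi.single 0 (2 * L + 1)) := by
  have hxω := apply_zero_mem_of_mem_brSpan hω
  have hxω' := apply_zero_mem_of_mem_brSpan hω'
  obtain ⟨hb, hL⟩ := mem_brSpan.1 hω
  obtain ⟨hb', hL'⟩ := mem_brSpan.1 hω'
  obtain ⟨h0, -, hadj, hinj⟩ := mem_saws.1 (mem_bridges.1 hb).1
  obtain ⟨h0', -, hadj', hinj'⟩ := mem_saws.1 (mem_bridges.1 hb').1
  have hR0 : reflAt (0 : Fin (d + 1)) (2 * L + 1) 0 = Pi.single 0 (2 * L + 1) := by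
    funext j
    by_cases hj : j = 0
    · subst hj; simp
    · rw [reflAt_apply_of_ne hj, Pi.single_eq_of_ne hj]; rfl
  refine mem_sawFun.2 ⟨by rw [reflJoin_of_le (Nat.zero_le _), h0], fun i hi => ?_, fun i hi => ?_, ?_⟩
  · rw [reflJoin_of_gt (by omega), show 2 * N + 1 - i = 0 by omega, h0', hR0]
  · rcases lt_trichotomy (i + 1) (N + 1) with h | h | h
    · rw [reflJoin_of_le (by omega), reflJoin_of_le (by omega)]; exact hadj i (by omega)
    · have hi' : i = N := by omega
      subst hi'
      rw [reflJoin_of_le le_rfl, reflJoin_of_gt (Nat.lt_succ_self _), show 2 * i + 1 - (i + 1) = i by omega, hend]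
      -- the step across the mirror: `x ↦ reflAt x` at level `L`
      have hlev : ω' i 0 = L := hL'
      have : reflAt 0 (2 * L + 1) (ω' i) = ω' i + Pi.single 0 1 := by
        funext j
        by_cases hj : j = 0
        · subst hj
          rw [reflAt_apply_same, Pi.add_apply, Pi.single_eq_same, hlev]; ring
        · rw [reflAt_apply_of_ne hj, Pi.add_apply, Pi.single_eq_of_ne hj, add_zero]
      rw [this]
      exact (zdGraph_adj_iff _ _).2 ⟨0, Or.inl rfl⟩
    · rw [reflJoin_of_gt (by omega), reflJoin_of_gt (by omega)]
      have e : 2 * N + 1 - i = (2 * N + 1 - (i + 1)) + 1 := by omega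
      rw [e]
      exact (zdGraph_adj_reflAt 0 (2 * L + 1) _ _).2 (hadj' _ (by omega)).symm
  · intro i hi j hj hij
    simp only [Set.mem_setOf_eq] at hi hj
    rcases le_or_gt i N with hiN | hiN <;> rcases le_or_gt j N with hjN | hjN
    · rw [reflJoin_of_le hiN, reflJoin_of_le hjN] at hij
      exact hinj hiN hjN hij
    · exfalso
      rw [reflJoin_of_le hiN, reflJoin_of_gt hjN] at hij
      have h1 := (hxω i).2
      have h2 := (hxω' (2 * N + 1 - j)).2
      have := congrFun hij 0
      rw [reflAt_apply_same] at this
      omega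
    · exfalso
      rw [reflJoin_of_gt hiN, reflJoin_of_le hjN] at hij
      have h1 := (hxω j).2
      have h2 := (hxω' (2 * N + 1 - i)).2
      have := congrFun hij 0
      rw [reflAt_apply_same] at this
      omega
    · rw [reflJoin_of_gt hiN, reflJoin_of_gt hjN] at hij
      have h := reflAt_injective 0 (2 * L + 1) hij
      have := hinj' (show 2 * N + 1 - i ≤ N by omega) (show 2 * N + 1 - j ≤ N by omega) h
      omega

/-- The pair of bridges is recovered from the reflected join. [folklore] -/
private theorem reflJoin_injective {N : ℕ} {L : ℤ} {ω₁ ω₁' ω₂ ω₂' : ℕ → Site (d + 1)}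
    (h₁ : ω₁ ∈ brSpan (d + 1) N L) (h₁' : ω₁' ∈ brSpan (d + 1) N L)
    (h₂ : ω₂ ∈ brSpan (d + 1) N L) (h₂' : ω₂' ∈ brSpan (d + 1) N L)
    (h : reflJoin N L ω₁ ω₁' = reflJoin N L ω₂ ω₂') : ω₁ = ω₂ ∧ ω₁' = ω₂' := by
  obtain ⟨-, he₁, -, -⟩ := mem_saws.1 (mem_bridges.1 (mem_brSpan.1 h₁).1).1
  obtain ⟨-, he₁', -, -⟩ := mem_saws.1 (mem_bridges.1 (mem_brSpan.1 h₁').1).1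
  obtain ⟨-, he₂, -, -⟩ := mem_saws.1 (mem_bridges.1 (mem_brSpan.1 h₂).1).1
  obtain ⟨-, he₂', -, -⟩ := mem_saws.1 (mem_bridges.1 (mem_brSpan.1 h₂').1).1
  constructor
  · funext i
    rcases le_or_gt i N with hi | hi
    · have := congrFun h i
      rwa [reflJoin_of_le hi, reflJoin_of_le hi] at this
    · rw [he₁ i hi.le, he₂ i hi.le]
      have := congrFun h N
      rwa [reflJoin_of_le le_rfl, reflJoin_of_le le_rfl] at this
  · funext j
    rcases le_or_gt j N with hj | hj
    · have := congrFun h (2 * N + 1 - j)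
      rw [reflJoin_of_gt (by omega), reflJoin_of_gt (by omega), show 2 * N + 1 - (2 * N + 1 - j) = j by omega] at this
      exact reflAt_injective 0 (2 * L + 1) this
    · rw [he₁' j hj.le, he₂' j hj.le]
      have := congrFun h (N + 1)
      rw [reflJoin_of_gt (Nat.lt_succ_self _), reflJoin_of_gt (Nat.lt_succ_self _),
        show 2 * N + 1 - (N + 1) = N by omega] at this
      exact reflAt_injective 0 (2 * L + 1) this

/-- **`Σ_y b_{N,L,y}² ≤ c_{2N+1}(0 → (2L+1)e₁)`**: the pairs of span-`L` bridges with a common endpoint inject into the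
self-avoiding walks to `(2L+1)e₁`. [cite: MadrasSlade1993, §3.1 (reflection/unfolding of bridges)] -/
theorem card_endpoint_pairs_le_countAt (N : ℕ) (L : ℤ) :
    (((brSpan (d + 1) N L) ×ˢ (brSpan (d + 1) N L)).filter fun p => p.1 N = p.2 N).card ≤
      countAt (d + 1) (2 * N + 1) (Pi.single 0 (2 * L + 1)) := by
  classical
  rw [← card_sawFun]
  refine Finset.card_le_card_of_injOn (fun p => reflJoin N L p.1 p.2) (fun p hp => ?_) ?_
  · rw [Finset.mem_coe, Finset.mem_filter, Finset.mem_product] at hp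
    exact reflJoin_mem_sawFun hp.1.1 hp.1.2 hp.2
  · rintro ⟨a, a'⟩ ha ⟨b, b'⟩ hb h
    rw [Finset.mem_coe, Finset.mem_filter, Finset.mem_product] at ha hb
    obtain ⟨e1, e2⟩ := reflJoin_injective ha.1.1 ha.1.2 hb.1.1 hb.1.2 h
    exact Prod.ext e1 e2

/-- The endpoints of `N`-step bridges of span `L` in `ℤ^{d+1}`: at most `(2N+1)^d` of them. [folklore] -/
private theorem card_endpoints_le (N : ℕ) (L : ℤ) :
    ((brSpan (d + 1) N L).image fun ω => ω N).card ≤ (2 * N + 1) ^ d := by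
  classical
  set T : Finset (Fin d → ℤ) := Fintype.piFinset fun _ => Finset.Icc (-(N : ℤ)) N with hT
  have hTcard : T.card = (2 * N + 1) ^ d := by
    rw [hT, Fintype.card_piFinset, Finset.prod_const, Int.card_Icc, Finset.card_univ, Fintype.card_fin]
    congr 1; omega
  rw [← hTcard]
  refine Finset.card_le_card_of_injOn (fun y => Fin.tail y) (fun y hy => ?_) ?_
  · rw [Finset.mem_coe, Finset.mem_image] at hy
    obtain ⟨ω, hω, rfl⟩ := hy
    rw [Finset.mem_coe, hT, Fintype.mem_piFinset]
    intro j
    have hbox := apply_mem_box_of_mem_saws (mem_bridges.1 (mem_brSpan.1 hω).1).1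
    rw [mem_box] at hbox
    exact Finset.mem_Icc.2 (hbox j.succ)
  · intro y hy y' hy' h
    rw [Finset.mem_coe, Finset.mem_image] at hy hy'
    obtain ⟨ω, hω, rfl⟩ := hy
    obtain ⟨ω', hω', rfl⟩ := hy'
    have h0 : ω N 0 = ω' N 0 := by rw [(mem_brSpan.1 hω).2, (mem_brSpan.1 hω').2]
    funext j
    refine Fin.cases ?_ (fun j' => ?_) j
    · exact h0
    · exact congrFun h j'

/-- **The reflection bound for bridges by span** (`ℤ^{d+1}`, every `N` and `L`):
`b_{N,L}² ≤ (2N+1)^d · c_{2N+1}(0 → (2L+1)e₁)`.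
[cite: MadrasSlade1993, §3.1 (reflection/unfolding of bridges; Cauchy–Schwarz over the transverse endpoint)] -/
theorem card_brSpan_sq_le (N : ℕ) (L : ℤ) :
    (brSpan (d + 1) N L).card ^ 2 ≤ (2 * N + 1) ^ d * countAt (d + 1) (2 * N + 1) (Pi.single 0 (2 * L + 1)) := by
  classical
  set B := brSpan (d + 1) N L with hB
  set E := B.image fun ω => ω N with hE
  -- fibre decomposition `|B| = Σ_y |B_y|`
  have hfib : B.card = ∑ y ∈ E, (B.filter fun ω => ω N = y).card :=
    Finset.card_eq_sum_card_image _ _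
  -- pairs with a common endpoint: `Σ_y |B_y|²`
  have hpairs : ∑ y ∈ E, (B.filter fun ω => ω N = y).card ^ 2 =
      ((B ×ˢ B).filter fun p => p.1 N = p.2 N).card := by
    rw [Finset.card_eq_sum_card_image (fun p : (ℕ → Site (d + 1)) × (ℕ → Site (d + 1)) => p.1 N)
      ((B ×ˢ B).filter fun p => p.1 N = p.2 N)]
    have hEq : ((B ×ˢ B).filter fun p => p.1 N = p.2 N).image (fun p => p.1 N) = E := by
      ext y
      simp only [Finset.mem_image, Finset.mem_filter, Finset.mem_product, hE]
      constructor
      · rintro ⟨p, ⟨⟨hp1, -⟩, -⟩, rfl⟩; exact ⟨p.1, hp1, rfl⟩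
      · rintro ⟨ω, hω, rfl⟩; exact ⟨(ω, ω), ⟨⟨hω, hω⟩, rfl⟩, rfl⟩
    rw [hEq]
    refine Finset.sum_congr rfl fun y _ => ?_
    rw [sq, ← Finset.card_product]
    congr 1
    ext p
    simp only [Finset.mem_filter, Finset.mem_product]
    constructor
    · rintro ⟨⟨h1, e1⟩, ⟨h2, e2⟩⟩; exact ⟨⟨⟨h1, h2⟩, by rw [e1, e2]⟩, e1⟩
    · rintro ⟨⟨⟨h1, h2⟩, e⟩, e1⟩; exact ⟨⟨h1, e1⟩, ⟨h2, by rw [← e, e1]⟩⟩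
  have hCS := sq_sum_le_card_mul_sum_sq (s := E) (f := fun y => (B.filter fun ω => ω N = y).card)
  rw [← hfib, hpairs] at hCS
  calc B.card ^ 2 ≤ E.card * ((B ×ˢ B).filter fun p => p.1 N = p.2 N).card := hCS
    _ ≤ (2 * N + 1) ^ d * countAt (d + 1) (2 * N + 1) (Pi.single 0 (2 * L + 1)) :=
        Nat.mul_le_mul (card_endpoints_le N L) (card_endpoint_pairs_le_countAt N L)

/-- `c_n(0,x)` as the number of `n`-step self-avoiding vertex functions ending at `x`. [folklore] -/
private theorem card_filter_saws_eq_countAt (n : ℕ) (x : Site (d + 1)) :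
    ((saws (d + 1) n).filter fun ω => ω n = x).card = countAt (d + 1) n x := by
  classical
  rw [← card_sawFun]
  congr 1
  ext ω
  rw [Finset.mem_filter, mem_sawFun_iff_mem_saws]

/-- **R29.2 in the lane's typed shape** (`stub_R29_reflect` of a-idea-1's Sketch_G7: real cast, `saws`-filter at the axis
point `(2L+1)e₁`).
[cite: MadrasSlade1993, §3.1 (reflection/unfolding of bridges; Cauchy–Schwarz over the transverse endpoint)] -/
theorem card_brSpan_sq_le_real (N L : ℕ) :
    ((brSpan (d + 1) N (L : ℤ)).card : ℝ) ^ 2 ≤ ((2 * N + 1 : ℕ) : ℝ) ^ d *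
      (((saws (d + 1) (2 * N + 1)).filter fun ω => ω (2 * N + 1) = axisPoint (d + 1) ((2 * L + 1 : ℕ) : ℤ)).card : ℝ) := by
  rw [card_filter_saws_eq_countAt, axisPoint_eq_single ((2 * L + 1 : ℕ) : ℤ)]
  have h := card_brSpan_sq_le (d := d) N (L : ℤ)
  have e : ((2 * L + 1 : ℕ) : ℤ) = 2 * (L : ℤ) + 1 := by push_cast; ring
  rw [e]
  exact_mod_cast h

end Literature.Probability.RandomPlanarGeometry.SAW.Zd
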